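import Summits.AtomisticToContinuum.Crystallization.Theorems.FrustratedLawDichotomyStrainedPatchHomParamTransferMul
import Summits.AtomisticToContinuum.Crystallization.Theorems.FrustratedLawDichotomyStrainedPatchHomEntryFitHcpSharpCollar
import Summits.AtomisticToContinuum.Crystallization.Theorems.FrustratedLawDichotomyStrainedPatchHomCurvCentreKit

/-!
# The U-COLLAR LEAF: ONE thin robust fit certificate at the CENTRE strain `U_c = cenMap c₀` certifies every cell whose `U`-box is within operator
# distance `κ₀` of `U_c` and whose shuffle box is within the remaining ξ-collar — the 9-dimensional collar of `…ParamTransferMul` as a kernel Boolean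

decomp-a2c hand-2 g41 — structural share for the crux `AperiodicFrustratedLawGap` (stmt-AtomisticToContinuum-27623; `(H) HomFloor`, hcp half);
the port of #28 `…ParamTransferMul.hcpLeafGoal_of_uCollar` (this generation), on top of #27's sharp ξ-collar and the tree's centre map `cenMap`.

THE LEAF.  Data: a thin box `(c₀, w₀)` — only its CENTRE `U`-entries matter for the base strain (`cenMap c₀`, the kit is still evaluated on the box
as given), a rotation index `q`, collar radius `ρS`, residual budget `e0S` (the thin certificate `fitOKHDCRSρ c₀ w₀ q ρS e0S`, unchanged), and PER
CELL two integer witnesses `K ≥ √E`, `Mx ≥ √X` (the driver's integer square roots; the kernel checks the squares) with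
`E := Σ_ab (|c_ab − c₀_ab| + w_ab)²` (the cell's `U`-excess over the centre, Frobenius, scale `SC²`) and `X := Σ_a (Σ_b M_ab Δ_b)²` (#27's sharp
ξ-collar functional).  `uCollarCellOK c₀ w₀ ρS K Mx c w` checks `w₀ ≥ 0` on the `U`-entries, `c₀` symmetric, `0 < ρS`, `0 ≤ K`, `E ≤ K²`, `4K < 3·SC`
(`κ₀ := K/SC < 3/4`), #27's `xiCollarSharpOK Mx (ρS·SC)` (⟹ `‖U'(ξ' − ξ)‖ ≤ Mx/SC²`) and the ONE budget inequality

  `10·Mx·(3·SC − 4K) + 124·K·SC² ≤ 10·ρS·SC·(3·SC − 4K)`   ⟺   `Mx/SC² + (31/10)·κ ≤ ρS/SC`,  `κ := κ₀/(3/4 − κ₀) = 4K/(3·SC − 4K)`.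

Soundness `semOKHQ_of_uCollarLeafOK`: base `U := cenMap c₀` (self-adjoint because `c₀` is symmetric; inside the thin box because `w₀ ≥ 0`), the
robust package there by `fitOKHDCRSρ_sound`, `‖U' − cenMap c₀‖ ≤ K/SC` by the tree's Frobenius lemma, then #28's `rel_of_opNorm` + `perturbU` +
`shift` (`hcpLeafGoal_of_perturbU_collar`).  NO containment of the cell's `U`-box in the thin `U`-box is asked: the cell may stick out of the thin
box in all nine directions — that is the point (fat leaf #25: 3 shuffle directions; cone leaf #26: + the dilation ray; here: all of `(U, ξ)`).
List edition `uCollarLeavesOK` (thin certificate ONCE + per-cell `(K, Mx, c, w)`), `semFactsQ_of_uCollarLeavesOK(_map)`.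

Pure bookkeeping over landed theorems + one self-adjointness computation; 0 sorry; standard axioms; no instances / notation / `#eval`.
`--supports stmt-AtomisticToContinuum-27623`.
-/

noncomputable section

namespace Summit.AtomisticToContinuum.Crystallization.Theorems.FrustratedLawDichotomyStrainedPatchHomEntryFitHcpUCollarLeaf

open scoped BigOperators RealInnerProductSpace
open Literature.Analysis.ValidatedNumerics.Numerics
open Summit.AtomisticToContinuum.Crystallization.Theorems.ChargedEnergyGapNegative (E3)
open Summit.AtomisticToContinuum.Crystallization.Theorems.FrustratedLawDichotomyStrainedPatchHomEntryHcpFrame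
open Summit.AtomisticToContinuum.Crystallization.Theorems.FrustratedLawDichotomyStrainedPatchHomEntryLeafHT (HcpLeafGoal)
open Summit.AtomisticToContinuum.Crystallization.Theorems.FrustratedLawDichotomyStrainedPatchHomParamTransfer (HcpFitCoreRobust)
open Summit.AtomisticToContinuum.Crystallization.Theorems.FrustratedLawDichotomyStrainedPatchHomParamTransferMul (hcpLeafGoal_of_perturbU_collar
  rel_of_opNorm opNorm_sub_le_of_entries)
open Summit.AtomisticToContinuum.Crystallization.Theorems.FrustratedLawDichotomyStrainedPatchHomCurvCentreKit (cenMap cenMap_apply cenMap_entry)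
open Summit.AtomisticToContinuum.Crystallization.Theorems.FrustratedLawDichotomyStrainedPatchHomEntryFitHcpKit (dEnclH)
open Summit.AtomisticToContinuum.Crystallization.Theorems.FrustratedLawDichotomyStrainedPatchHomEntryFitHcpCentred (fitOKHDCRSρ fitOKHDCRSρ_sound)
open Summit.AtomisticToContinuum.Crystallization.Theorems.FrustratedLawDichotomyStrainedPatchHomEntrySemanticQuot (semOKHQ semOKHQ_of_sound)
open Summit.AtomisticToContinuum.Crystallization.Theorems.FrustratedLawDichotomyStrainedPatchHomEntryFitHcpFatLeaf (xiDelta)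
open Summit.AtomisticToContinuum.Crystallization.Theorems.FrustratedLawDichotomyStrainedPatchHomEntryFitHcpSharpCollar (xiCollarSharpOK
  xiCollarSharpOK_spec norm_apply_sub_le_of_sharp exists_clamp_near_coord)

/-! ## §1. The centre strain `cenMap c₀` as the base of the collar -/

/-- `cenMap c₀` is self-adjoint when the centre entries are symmetric. [linear algebra: swap a double sum] -/
theorem cenMap_selfAdjoint {c₀ : (Fin 3 × Fin 3) ⊕ Fin 3 → ℤ} (hc : ∀ a b : Fin 3, c₀ (Sum.inl (a, b)) = c₀ (Sum.inl (b, a))) (v v' : E3) :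
    ⟪cenMap c₀ v, v'⟫ = ⟪v, cenMap c₀ v'⟫ := by
  simp only [PiLp.inner_apply, RCLike.inner_apply, conj_trivial, cenMap_apply, Finset.sum_mul, Finset.mul_sum]
  rw [Finset.sum_comm]
  refine Finset.sum_congr rfl fun k _ => Finset.sum_congr rfl fun l _ => ?_
  rw [hc l k]
  ring

/-- `cenMap c₀` lies in the thin `U`-box `(c₀, w₀)` whenever `w₀ ≥ 0` on the `U`-entries. [formal bookkeeping] -/
theorem cenMap_box_of_nonneg {c₀ w₀ : (Fin 3 × Fin 3) ⊕ Fin 3 → ℤ} (hw : ∀ ab : Fin 3 × Fin 3, 0 ≤ w₀ (Sum.inl ab)) (ab : Fin 3 × Fin 3) :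
    |(cenMap c₀ (EuclideanSpace.single ab.2 (1 : ℝ))) ab.1 - (c₀ (Sum.inl ab) : ℝ) / SC| ≤ (w₀ (Sum.inl ab) : ℝ) / SC := by
  obtain ⟨a, b⟩ := ab
  rw [cenMap_entry, sub_self, abs_zero]
  have h0 : (0 : ℝ) ≤ (w₀ (Sum.inl (a, b)) : ℝ) := by exact_mod_cast hw (a, b)
  exact div_nonneg h0 SC_pos.le

/-- The entry distance from the cell's strain to the centre strain: `|(U' e_b)_a − (cenMap c₀ e_b)_a| ≤ (|c_ab − c₀_ab| + w_ab)/SC`. [arithmetic] -/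
theorem abs_entry_sub_cenMap_le {c₀ c w : (Fin 3 × Fin 3) ⊕ Fin 3 → ℤ} {U' : E3 →L[ℝ] E3}
    (hbox : ∀ ab : Fin 3 × Fin 3, |(U' (EuclideanSpace.single ab.2 (1 : ℝ))) ab.1 - (c (Sum.inl ab) : ℝ) / SC| ≤ (w (Sum.inl ab) : ℝ) / SC)
    (a b : Fin 3) :
    |(U' (EuclideanSpace.single b (1 : ℝ))) a - (cenMap c₀ (EuclideanSpace.single b (1 : ℝ))) a| ≤
      ((|c (Sum.inl (a, b)) - c₀ (Sum.inl (a, b))| + w (Sum.inl (a, b)) : ℤ) : ℝ) / SC := by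
  have hS : (0 : ℝ) < SC := SC_pos
  rw [cenMap_entry]
  have h1 := hbox (a, b)
  have h2 : |(c (Sum.inl (a, b)) : ℝ) / SC - (c₀ (Sum.inl (a, b)) : ℝ) / SC| = |(c (Sum.inl (a, b)) : ℝ) - c₀ (Sum.inl (a, b))| / SC := by
    rw [← sub_div, abs_div, abs_of_pos hS]
  have h3 := abs_sub_le ((U' (EuclideanSpace.single b (1 : ℝ))) a) ((c (Sum.inl (a, b)) : ℝ) / SC) ((c₀ (Sum.inl (a, b)) : ℝ) / SC)
  rw [h2] at h3
  push_cast [add_div]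
  linarith

/-! ## §2. The Boolean tests -/

/-- The cell's squared `U`-excess over the centre, Frobenius: `E := Σ_ab (|c_ab − c₀_ab| + w_ab)²` (scale `SC²`). -/
def uExcessSq (c₀ c w : (Fin 3 × Fin 3) ⊕ Fin 3 → ℤ) : ℤ :=
  ∑ a : Fin 3, ∑ b : Fin 3, (|c (Sum.inl (a, b)) - c₀ (Sum.inl (a, b))| + w (Sum.inl (a, b))) ^ 2

/-- ★ The cheap U-COLLAR CELL test with witnesses `K ≥ √E`, `Mx ≥ √X`: thin `U`-half-widths `≥ 0`, `c₀` symmetric, `0 < ρS`, `0 ≤ K`, `E ≤ K²`,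
`4K < 3·SC`, `0 ≤ Mx`, #27's sharp ξ-collar at `(sN, sD) = (Mx, ρS·SC)` (i.e. `‖U'(ξ' − ξ)‖ ≤ Mx/SC²`), and the budget
`10·Mx·(3·SC − 4K) + 124·K·SC² ≤ 10·ρS·SC·(3·SC − 4K)`. -/
def uCollarCellOK (c₀ w₀ : (Fin 3 × Fin 3) ⊕ Fin 3 → ℤ) (ρS K Mx : ℤ) (c w : (Fin 3 × Fin 3) ⊕ Fin 3 → ℤ) : Bool :=
  ((List.finRange 3).all fun a => (List.finRange 3).all fun b =>
      decide (0 ≤ w₀ (Sum.inl (a, b))) && decide (c₀ (Sum.inl (a, b)) = c₀ (Sum.inl (b, a)))) &&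
    decide (0 < ρS) && decide (0 ≤ K) && decide (uExcessSq c₀ c w ≤ K ^ 2) && decide (4 * K < 3 * SC) && decide (0 ≤ Mx) &&
    xiCollarSharpOK Mx (ρS * SC) c₀ w₀ ρS c w &&
    decide (10 * Mx * (3 * SC - 4 * K) + 124 * K * SC ^ 2 ≤ 10 * ρS * SC * (3 * SC - 4 * K))

/-- ★ **THE U-COLLAR LEAF**: the cell test ∧ the thin robust certificate `fitOKHDCRSρ c₀ w₀ q ρS e0S`. -/
def uCollarLeafOK (c₀ w₀ : (Fin 3 × Fin 3) ⊕ Fin 3 → ℤ) (q : Fin 4 → ℤ) (ρS e0S K Mx : ℤ) (c w : (Fin 3 × Fin 3) ⊕ Fin 3 → ℤ) : Bool :=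
  uCollarCellOK c₀ w₀ ρS K Mx c w && fitOKHDCRSρ c₀ w₀ q ρS e0S

/-- ONE thin certificate + a LIST of U-collar cells `(K, Mx, c, w)`. -/
def uCollarLeavesOK (c₀ w₀ : (Fin 3 × Fin 3) ⊕ Fin 3 → ℤ) (q : Fin 4 → ℤ) (ρS e0S : ℤ)
    (L : List (ℤ × ℤ × ((Fin 3 × Fin 3) ⊕ Fin 3 → ℤ) × ((Fin 3 × Fin 3) ⊕ Fin 3 → ℤ))) : Bool :=
  fitOKHDCRSρ c₀ w₀ q ρS e0S && L.all fun b => uCollarCellOK c₀ w₀ ρS b.1 b.2.1 b.2.2.1 b.2.2.2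

/-- Reading `uCollarCellOK`. [formal bookkeeping] -/
theorem uCollarCellOK_spec {c₀ w₀ c w : (Fin 3 × Fin 3) ⊕ Fin 3 → ℤ} {ρS K Mx : ℤ} (h : uCollarCellOK c₀ w₀ ρS K Mx c w = true) :
    (∀ ab : Fin 3 × Fin 3, 0 ≤ w₀ (Sum.inl ab)) ∧ (∀ a b : Fin 3, c₀ (Sum.inl (a, b)) = c₀ (Sum.inl (b, a))) ∧ 0 < ρS ∧ 0 ≤ K ∧
      uExcessSq c₀ c w ≤ K ^ 2 ∧ 4 * K < 3 * SC ∧ 0 ≤ Mx ∧ xiCollarSharpOK Mx (ρS * SC) c₀ w₀ ρS c w = true ∧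
      10 * Mx * (3 * SC - 4 * K) + 124 * K * SC ^ 2 ≤ 10 * ρS * SC * (3 * SC - 4 * K) := by
  simp only [uCollarCellOK, List.all_eq_true, List.mem_finRange, true_implies, Bool.and_eq_true, decide_eq_true_eq] at h
  obtain ⟨⟨⟨⟨⟨⟨⟨hwb, hρ⟩, hK⟩, hE⟩, h43⟩, hMx⟩, hsharp⟩, hbud⟩ := h
  exact ⟨fun ab => (hwb ab.1 ab.2).1, fun a b => (hwb a b).2, hρ, hK, hE, h43, hMx, hsharp, hbud⟩

/-! ## §3. Soundness -/

/-- The budget inequality over the reals: with `D := 3·SC − 4K > 0`, `κ := 4K/D`,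
`10·Mx·D + 124·K·SC² ≤ 10·ρS·SC·D` gives `31/10·κ ≤ ρS/SC` and `Mx/SC² ≤ ρS/SC − 31/10·κ`. [arithmetic] -/
theorem budget_real {K Mx ρS : ℝ} {S : ℝ} (hS : 0 < S) (hD : 0 < 3 * S - 4 * K) (hMx : 0 ≤ Mx)
    (h : 10 * Mx * (3 * S - 4 * K) + 124 * K * S ^ 2 ≤ 10 * ρS * S * (3 * S - 4 * K)) :
    31 / 10 * (4 * K / (3 * S - 4 * K)) ≤ ρS / S ∧ Mx / S ^ 2 ≤ ρS / S - 31 / 10 * (4 * K / (3 * S - 4 * K)) := by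
  set D := 3 * S - 4 * K with hDdef
  have hD0 : D ≠ 0 := ne_of_gt hD
  have hS0 : S ≠ 0 := ne_of_gt hS
  have key : ρS / S - 31 / 10 * (4 * K / D) - Mx / S ^ 2 = (10 * ρS * S * D - 124 * K * S ^ 2 - 10 * Mx * D) / (10 * S ^ 2 * D) := by
    field_simp
    ring
  have hnum : 0 ≤ 10 * ρS * S * D - 124 * K * S ^ 2 - 10 * Mx * D := by linarith
  have hfrac : 0 ≤ ρS / S - 31 / 10 * (4 * K / D) - Mx / S ^ 2 := by rw [key]; positivity
  have hMx' : 0 ≤ Mx / S ^ 2 := by positivity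
  constructor <;> linarith

/-- `κ₀/(3/4 − κ₀) = 4K/(3·SC − 4K)` for `κ₀ = K/SC`. [arithmetic] -/
theorem kappa_eq {K S : ℝ} (hS : 0 < S) (hD : 0 < 3 * S - 4 * K) : K / S / (3 / 4 - K / S) = 4 * K / (3 * S - 4 * K) := by
  have hS0 : S ≠ 0 := ne_of_gt hS
  have hD0 : 3 * S - 4 * K ≠ 0 := ne_of_gt hD
  have h34 : 3 / 4 - K / S = (3 * S - 4 * K) / (4 * S) := by
    field_simp
  have h1 : 3 / 4 - K / S ≠ 0 := by rw [h34]; positivity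
  rw [div_eq_div_iff h1 hD0, h34]
  field_simp

/-- ★★ **U-COLLAR CELL ⟹ hcp leaf goal** at every admissible `(U', ξ')` of the cell, every level. [bookkeeping over `fitOKHDCRSρ_sound` at
`cenMap c₀` + `…ParamTransferMul.hcpLeafGoal_of_perturbU_collar`; distances by the Frobenius lemma and #27's sharp collar] -/
theorem hcpLeafGoal_of_uCollarCellOK {c₀ w₀ c w : (Fin 3 × Fin 3) ⊕ Fin 3 → ℤ} {q : Fin 4 → ℤ} {ρS e0S K Mx : ℤ}
    (hcell : uCollarCellOK c₀ w₀ ρS K Mx c w = true) (hfit : fitOKHDCRSρ c₀ w₀ q ρS e0S = true)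
    (U' : E3 →L[ℝ] E3) (ξ' : E3) (hU' : ‖U' - 1‖ ≤ 1 / 4) (hξ' : ‖ξ'‖ ≤ 1 / 4)
    (hbox : ∀ ab : Fin 3 × Fin 3, |(U' (EuclideanSpace.single ab.2 (1 : ℝ))) ab.1 - (c (Sum.inl ab) : ℝ) / SC| ≤ (w (Sum.inl ab) : ℝ) / SC)
    (hξb : ∀ i : Fin 3, |ξ' i - (c (Sum.inr i) : ℝ) / SC| ≤ (w (Sum.inr i) : ℝ) / SC) (μ : ℤ) : HcpLeafGoal μ U' ξ' := by
  obtain ⟨hw₀U, hsym, hρS, hK, hE, h43, hMx, hsharp, hbud⟩ := uCollarCellOK_spec hcell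
  have hS : (0 : ℝ) < SC := SC_pos
  have hw₀ξ : ∀ i : Fin 3, (0 : ℤ) ≤ w₀ (Sum.inr i) := (xiCollarSharpOK_spec hsharp).1
  -- the base: centre strain, clamped shuffle, robust package from the thin certificate
  set U : E3 →L[ℝ] E3 := cenMap c₀ with hUdef
  have hsaU : ∀ v v' : E3, ⟪U v, v'⟫ = ⟪v, U v'⟫ := cenMap_selfAdjoint hsym
  have hbox₀ : ∀ ab : Fin 3 × Fin 3,
      |(U (EuclideanSpace.single ab.2 (1 : ℝ))) ab.1 - (c₀ (Sum.inl ab) : ℝ) / SC| ≤ (w₀ (Sum.inl ab) : ℝ) / SC := cenMap_box_of_nonneg hw₀U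
  obtain ⟨ξ, hξT, hδ⟩ := exists_clamp_near_coord hw₀ξ hξb
  obtain ⟨-, R, hR⟩ := fitOKHDCRSρ_sound hfit U ξ hsaU hbox₀ hξT
  have hR' : HcpFitCoreRobust U ξ R (4999 / 100000) (((dEnclH c₀ w₀).lo : ℝ) / SC) (((dEnclH c₀ w₀).hi : ℝ) / SC) ((ρS : ℝ) / SC)
      ((e0S : ℝ) / SC) := hR
  -- the operator distance `‖U' − cenMap c₀‖ ≤ K/SC`
  have hK0 : (0 : ℝ) ≤ K := by exact_mod_cast hK
  have hEr : ((uExcessSq c₀ c w : ℤ) : ℝ) ≤ (K : ℝ) ^ 2 := by exact_mod_cast hE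
  have hκ₀ : ‖U' - U‖ ≤ (K : ℝ) / SC := by
    have h1 := opNorm_sub_le_of_entries (U' := U') (U := U)
      (ε := fun a b => ((|c (Sum.inl (a, b)) - c₀ (Sum.inl (a, b))| + w (Sum.inl (a, b)) : ℤ) : ℝ) / SC)
      (fun a b => abs_entry_sub_cenMap_le hbox a b)
    have h2 : ∑ a : Fin 3, ∑ b : Fin 3, (((|c (Sum.inl (a, b)) - c₀ (Sum.inl (a, b))| + w (Sum.inl (a, b)) : ℤ) : ℝ) / SC) ^ 2 =
        ((uExcessSq c₀ c w : ℤ) : ℝ) / SC ^ 2 := by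
      push_cast [uExcessSq, Finset.sum_div]
      refine Finset.sum_congr rfl fun a _ => Finset.sum_congr rfl fun b _ => ?_
      rw [div_pow]
    rw [h2, Real.sqrt_div' _ (by positivity), Real.sqrt_sq hS.le] at h1
    refine h1.trans (div_le_div_of_nonneg_right ?_ hS.le)
    calc Real.sqrt ((uExcessSq c₀ c w : ℤ) : ℝ) ≤ Real.sqrt ((K : ℝ) ^ 2) := Real.sqrt_le_sqrt hEr
      _ = K := Real.sqrt_sq hK0
  -- the budget in real form
  have hDz : (0 : ℝ) < 3 * SC - 4 * K := by
    have : (4 : ℝ) * K < 3 * SC := by exact_mod_cast h43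
    linarith
  have hMx0 : (0 : ℝ) ≤ Mx := by exact_mod_cast hMx
  have hbudr : (10 : ℝ) * Mx * (3 * SC - 4 * K) + 124 * K * (SC : ℝ) ^ 2 ≤ 10 * ρS * SC * (3 * SC - 4 * K) := by exact_mod_cast hbud
  obtain ⟨hκ31, hcollar⟩ := budget_real hS hDz hMx0 hbudr
  have hlt : (K : ℝ) / SC < 3 / 4 := by rw [div_lt_iff₀ hS]; linarith
  have hκeq := kappa_eq (K := (K : ℝ)) hS hDz
  -- the relative perturbation and the two collar inequalities in the `κ` of `rel_of_opNorm`
  have hrel := rel_of_opNorm hU' hκ₀ hlt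
  have hκ0 : (0 : ℝ) ≤ (K : ℝ) / SC / (3 / 4 - (K : ℝ) / SC) := by rw [hκeq]; positivity
  have hκ : 31 / 10 * ((K : ℝ) / SC / (3 / 4 - (K : ℝ) / SC)) ≤ (ρS : ℝ) / SC := by rw [hκeq]; exact hκ31
  -- the ξ-collar: `‖U'(ξ' − ξ)‖ ≤ Mx/SC² ≤ ρ − 31/10 κ`
  have hρSr : (0 : ℝ) ≤ ρS := by exact_mod_cast hρS.le
  have hsD : 0 < ρS * SC := mul_pos hρS (by exact_mod_cast Nat.pos_of_ne_zero (by norm_num [SC]))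
  have hnear := norm_apply_sub_le_of_sharp hsharp hsD hρSr hMx0 hbox hδ
  have hMxeq : ((Mx : ℤ) : ℝ) / ((ρS * SC : ℤ) : ℝ) * ((ρS : ℝ) / SC) = (Mx : ℝ) / (SC : ℝ) ^ 2 := by
    have hρ0 : (ρS : ℝ) ≠ 0 := ne_of_gt (by exact_mod_cast hρS)
    push_cast
    field_simp
  rw [hMxeq] at hnear
  have hρ' : ‖U' (ξ' - ξ)‖ ≤ (ρS : ℝ) / SC - 31 / 10 * ((K : ℝ) / SC / (3 / 4 - (K : ℝ) / SC)) := by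
    rw [hκeq]; exact hnear.trans hcollar
  have hξ'2 : ‖ξ'‖ ≤ 1 / 2 := hξ'.trans (by norm_num)
  exact hcpLeafGoal_of_perturbU_collar hR' hrel hκ0 hκ hρ' hU' hξ'2 μ

/-- ★★ **SOUNDNESS IN THE QUOTIENT CURRENCY**: a cell accepted by the U-collar leaf is a `semOKHQ` fact at every level `μ`. [formal bookkeeping] -/
theorem semOKHQ_of_uCollarLeafOK {μ : ℤ} {c₀ w₀ c w : (Fin 3 × Fin 3) ⊕ Fin 3 → ℤ} {q : Fin 4 → ℤ} {ρS e0S K Mx : ℤ}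
    (h : uCollarLeafOK c₀ w₀ q ρS e0S K Mx c w = true) : semOKHQ μ c w = true :=
  semOKHQ_of_sound (uCollarLeafOK c₀ w₀ q ρS e0S K Mx)
    (fun _ _ hv U ξ _ _ hU hξ hbox hξb _ _ => by
      simp only [uCollarLeafOK, Bool.and_eq_true] at hv
      exact hcpLeafGoal_of_uCollarCellOK hv.1 hv.2 U ξ hU hξ hbox hξb μ) h

/-- ★★ **A LIST OF U-COLLAR CELLS OVER ONE THIN CERTIFICATE** ⟹ `semOKHQ` facts on `(c, w)` of every listed `(K, Mx, c, w)`, every level.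
[formal bookkeeping] -/
theorem semFactsQ_of_uCollarLeavesOK {μ : ℤ} {c₀ w₀ : (Fin 3 × Fin 3) ⊕ Fin 3 → ℤ} {q : Fin 4 → ℤ} {ρS e0S : ℤ}
    {L : List (ℤ × ℤ × ((Fin 3 × Fin 3) ⊕ Fin 3 → ℤ) × ((Fin 3 × Fin 3) ⊕ Fin 3 → ℤ))}
    (h : uCollarLeavesOK c₀ w₀ q ρS e0S L = true) : ∀ b ∈ L, semOKHQ μ b.2.2.1 b.2.2.2 = true := by
  simp only [uCollarLeavesOK, Bool.and_eq_true] at h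
  intro b hb
  refine semOKHQ_of_uCollarLeafOK (q := q) (e0S := e0S) (c₀ := c₀) (w₀ := w₀) (ρS := ρS) (K := b.1) (Mx := b.2.1) ?_
  simp only [uCollarLeafOK, Bool.and_eq_true]
  exact ⟨List.all_eq_true.1 h.2 b hb, h.1⟩

/-- The same list read on the `(c, w)` projections (the `…HomCutTreeFacts.facts_of_all_sound` shape). [formal bookkeeping] -/
theorem semFactsQ_of_uCollarLeavesOK_map {μ : ℤ} {c₀ w₀ : (Fin 3 × Fin 3) ⊕ Fin 3 → ℤ} {q : Fin 4 → ℤ} {ρS e0S : ℤ}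
    {L : List (ℤ × ℤ × ((Fin 3 × Fin 3) ⊕ Fin 3 → ℤ) × ((Fin 3 × Fin 3) ⊕ Fin 3 → ℤ))}
    (h : uCollarLeavesOK c₀ w₀ q ρS e0S L = true) : ∀ b ∈ L.map fun b => b.2.2, semOKHQ μ b.1 b.2 = true := by
  intro b hb
  obtain ⟨a, ha, rfl⟩ := List.mem_map.1 hb
  exact semFactsQ_of_uCollarLeavesOK h a ha

end Summit.AtomisticToContinuum.Crystallization.Theorems.FrustratedLawDichotomyStrainedPatchHomEntryFitHcpUCollarLeaf

end
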